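import Summits.Ventures.GridStability.Models.StructurePreservingDAEHessianMatrix
import HarnessLib

/-!
# GridStability/Models/StructurePreservingDAEHessianEntry — closed-form entries of the Gram matrix of
# the second variation (an `O(n)`-per-entry evaluator for kernel checks of large instances)

LADDER-GRIDFUSION G3 (model register), seat gridfusion-model-2 (g9); `plan/MODEL-VALIDITY.md` row
**MV-4** (c). Companion of `StructurePreservingDAEHessianMatrix.lean`, whose Gram matrix
`HessianTables.matrix` is ASSEMBLED as a sum of `m + n² + n` elementary symmetric pieces (the form in
which the identity with the second variation, `quad_eq_qf`, is proved). Evaluating ONE entry of that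
sum in the kernel walks every piece (measured ≈ 0.5 kernel-s per entry at `(m, n) = (3, 9)`); for a
39-bus instance (`87 × 87` pinned matrix, 1570 pieces) this is prohibitive. Here the same matrix is
given ENTRY BY ENTRY in closed form (`entry`: machine blocks by the terminal-bus fibre, network blocks
`θθ`, `θV`, `VV` with one sum over the buses on the diagonal only, load diagonal) and the two are
proved equal (`matrix_apply`, `matrix_eq_of_entry`) for arbitrary tables over any field of
characteristic zero — so an instance file may check its literal against `Matrix.of entry` instead.
APPEND (g9): `qf_pos_of_quadForm_pos` / `hessianQuad_pos_of_quadForm_pos` — the bridge of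
`StructurePreservingDAEHessianMatrix.lean` with ANY positivity proof of the pinned rational submatrix
as hypothesis (rounded-twin lane for the `87 × 87` 39-bus matrix, beyond in-kernel `LDLᵀ`).
[cite: Padiyar2013, §3.4.4 eqs (3.32)–(3.37)]. MODELLED column; no instance here.
-/

noncomputable section

open Finset Matrix

namespace Summit.Ventures.GridStability.Models.StructurePreservingDAE.HessianTables

variable {K : Type*} [Field K] {m n : ℕ}

/-! ### Closed-form entries of the Gram matrix (an `O(n)`-per-entry evaluator for kernel checks of
large instances; the piece sum `matrix` costs `O(m + n²)` elementary pieces per entry) -/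

/-- Off-diagonal-symmetrised network coefficient `θθ`: `−(B_pq V_p V_q C_pq + B_qp V_q V_p C_qp)/2`. -/
def thetaTheta (T : HessianTables K m n) (p q : Fin n) : K :=
  (if p = q then (∑ l, T.B p l * T.V p * T.V l * T.Cb p l) / 2
      + (∑ k, T.B k p * T.V k * T.V p * T.Cb k p) / 2
      + ∑ i, (if T.bus i = p then T.E i / T.X i * T.V (T.bus i) * T.Cm i else 0) else 0)
  - T.B p q * T.V p * T.V q * T.Cb p q / 2 - T.B q p * T.V q * T.V p * T.Cb q p / 2

/-- `θV` coefficient (row `θ_p`, column `V_q`). -/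
def thetaV (T : HessianTables K m n) (p q : Fin n) : K :=
  (if p = q then (∑ l, T.B p l * T.Sb p l * T.V l) / 2 - (∑ k, T.B k p * T.Sb k p * T.V k) / 2
      - ∑ i, (if T.bus i = p then T.E i / T.X i * T.Sm i else 0) else 0)
  + T.B p q * T.Sb p q * T.V p / 2 - T.B q p * T.Sb q p * T.V p / 2

/-- `VV` coefficient. -/
def vV (T : HessianTables K m n) (p q : Fin n) : K :=
  -(T.B p q * T.Cb p q + T.B q p * T.Cb q p) / 2
  + (if p = q then (∑ i, if T.bus i = p then 1 / T.X i else 0) - T.q p else 0)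

/-- **Closed-form entries of the Gram matrix** (`matrix_apply`): per entry a sum over at most one
bus index, instead of the `m + n² + n` elementary pieces of `matrix`. [cite: Padiyar2013, §3.4.4 eq (3.32)] -/
def entry (T : HessianTables K m n) : Idx m n → Idx m n → K
  | Sum.inl i, Sum.inl j => if i = j then T.E i / T.X i * T.V (T.bus i) * T.Cm i else 0
  | Sum.inl i, Sum.inr (Sum.inl k) =>
      if T.bus i = k then -(T.E i / T.X i * T.V (T.bus i) * T.Cm i) else 0
  | Sum.inl i, Sum.inr (Sum.inr k) => if T.bus i = k then T.E i / T.X i * T.Sm i else 0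
  | Sum.inr (Sum.inl k), Sum.inl i =>
      if T.bus i = k then -(T.E i / T.X i * T.V (T.bus i) * T.Cm i) else 0
  | Sum.inr (Sum.inr k), Sum.inl i => if T.bus i = k then T.E i / T.X i * T.Sm i else 0
  | Sum.inr (Sum.inl p), Sum.inr (Sum.inl q) => T.thetaTheta p q
  | Sum.inr (Sum.inl p), Sum.inr (Sum.inr q) => T.thetaV p q
  | Sum.inr (Sum.inr q), Sum.inr (Sum.inl p) => T.thetaV p q
  | Sum.inr (Sum.inr p), Sum.inr (Sum.inr q) => T.vV p q

/-- Entries of the symmetric elementary piece. [folklore] -/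
theorem cross_apply {ι : Type*} [DecidableEq ι] (I J : ι) (c : K) (I' J' : ι) :
    cross I J c I' J' = (if I = I' ∧ J = J' then c / 2 else 0)
      + (if J = I' ∧ I = J' then c / 2 else 0) := by
  simp [cross, Matrix.add_apply, Matrix.single, Matrix.of_apply]

variable [CharZero K]

omit [CharZero K] in
/-- Nested `if` on the same fibre condition. [folklore] -/
private theorem sum_ite_ite_same (T : HessianTables K m n) (k : Fin n) (f : Fin m → K) :
    (∑ x, if T.bus x = k then (if T.bus x = k then f x else 0) else 0)
      = ∑ x, if T.bus x = k then f x else 0 :=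
  Finset.sum_congr rfl fun x _ => by split_ifs <;> rfl

omit [CharZero K] in
/-- Nested `if` on two different fibres vanishes. [folklore] -/
private theorem sum_ite_ite_ne (T : HessianTables K m n) {k l : Fin n} (hkl : k ≠ l)
    (f : Fin m → K) :
    (∑ x, if T.bus x = k then (if T.bus x = l then f x else 0) else 0) = 0 :=
  Finset.sum_eq_zero fun x _ => by
    split_ifs with h1 h2
    · exact absurd (h1.symm.trans h2) hkl
    · rfl
    · rfl

omit [CharZero K] in
/-- A fibre sum against a point condition collapses. [folklore] -/
private theorem sum_ite_bus_ite_eq (T : HessianTables K m n) (k : Fin n) (j : Fin m)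
    (f : Fin m → K) :
    (∑ x, if T.bus x = k then (if x = j then f x else 0) else 0) = if T.bus j = k then f j else 0 := by
  rw [Finset.sum_eq_single_of_mem j (Finset.mem_univ _) fun x _ hx => by simp [hx]]
  simp

omit [CharZero K] in
/-- Pull a divisor out of a conditional sum. [folklore] -/
private theorem sum_ite_div (p : Fin m → Prop) [DecidablePred p] (f : Fin m → K) (c : K) :
    (∑ x, if p x then f x / c else 0) = (∑ x, if p x then f x else 0) / c := by
  rw [Finset.sum_div]
  exact Finset.sum_congr rfl fun x _ => by split_ifs <;> simp

/-- **The piece sum equals the closed form**, entry by entry (no hypothesis on the tables).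
[cite: Padiyar2013, §3.4.4 eq (3.32)] -/
theorem matrix_apply (T : HessianTables K m n) (I J : Idx m n) : T.matrix I J = T.entry I J := by
  rcases I with i | k | k <;> rcases J with j | l | l
  · simp only [matrix, entry, Matrix.add_apply, Matrix.sum_apply, machinePiece, networkPiece, loadPiece,
      cross_apply, Sum.inl.injEq, reduceCtorEq, and_false, false_and, if_false, if_true, and_self,
      Finset.sum_add_distrib, add_zero, zero_add, Finset.sum_const_zero, ite_and, Finset.sum_ite_eq',
      Finset.mem_univ]
    split_ifs <;> ring
  · simp only [matrix, entry, Matrix.add_apply, Matrix.sum_apply, machinePiece, networkPiece, loadPiece,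
      cross_apply, Sum.inl.injEq, Sum.inr.injEq, reduceCtorEq, and_false, false_and, if_false,
      if_true, and_self, Finset.sum_add_distrib, add_zero, zero_add, Finset.sum_const_zero, ite_and,
      Finset.sum_ite_eq', Finset.mem_univ]
    split_ifs <;> ring
  · simp only [matrix, entry, Matrix.add_apply, Matrix.sum_apply, machinePiece, networkPiece, loadPiece,
      cross_apply, Sum.inl.injEq, Sum.inr.injEq, reduceCtorEq, and_false, false_and, if_false,
      if_true, and_self, Finset.sum_add_distrib, add_zero, zero_add, Finset.sum_const_zero, ite_and,
      Finset.sum_ite_eq', Finset.mem_univ]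
    split_ifs <;> ring
  · simp only [matrix, entry, Matrix.add_apply, Matrix.sum_apply, machinePiece, networkPiece, loadPiece,
      cross_apply, Sum.inl.injEq, Sum.inr.injEq, reduceCtorEq, and_false, false_and, if_false,
      and_self, Finset.sum_add_distrib, add_zero, zero_add, Finset.sum_const_zero, ite_and]
    rw [sum_ite_bus_ite_eq]
    split_ifs <;> ring
  · simp only [matrix, entry, thetaTheta, Matrix.add_apply, Matrix.sum_apply, machinePiece, networkPiece,
      loadPiece, cross_apply, Sum.inl.injEq, Sum.inr.injEq, reduceCtorEq, and_false, false_and,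
      if_false, if_true, and_self, Finset.sum_add_distrib, add_zero, zero_add, Finset.sum_const_zero,
      ite_and, Finset.sum_ite_irrel, Finset.sum_ite_eq', Finset.mem_univ]
    by_cases hkl : k = l
    · subst hkl
      simp only [if_true, sum_ite_ite_same, sum_ite_div, ← Finset.sum_div]
      ring
    · simp only [hkl, if_false, sum_ite_ite_ne T hkl, zero_add, add_zero]
      ring
  · simp only [matrix, entry, thetaV, Matrix.add_apply, Matrix.sum_apply, machinePiece, networkPiece,
      loadPiece, cross_apply, Sum.inl.injEq, Sum.inr.injEq, reduceCtorEq, and_false, false_and,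
      if_false, if_true, and_self, Finset.sum_add_distrib, add_zero, zero_add, Finset.sum_const_zero,
      ite_and, Finset.sum_ite_irrel, Finset.sum_ite_eq', Finset.mem_univ]
    by_cases hkl : k = l
    · subst hkl
      have hm : (∑ x, if T.bus x = k then -(2 * (T.E x / T.X x) * T.Sm x) / 2 else 0)
          = -∑ x, if T.bus x = k then T.E x / T.X x * T.Sm x else 0 := by
        rw [← Finset.sum_neg_distrib]
        exact Finset.sum_congr rfl fun x _ => by split_ifs <;> ring
      simp only [if_true, sum_ite_ite_same, hm, ← Finset.sum_div, Finset.sum_neg_distrib]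
      ring
    · simp only [hkl, if_false, sum_ite_ite_ne T hkl, zero_add, add_zero]
      ring
  · simp only [matrix, entry, Matrix.add_apply, Matrix.sum_apply, machinePiece, networkPiece, loadPiece,
      cross_apply, Sum.inl.injEq, Sum.inr.injEq, reduceCtorEq, and_false, false_and, if_false,
      and_self, Finset.sum_add_distrib, add_zero, zero_add, Finset.sum_const_zero, ite_and]
    rw [sum_ite_bus_ite_eq]
    split_ifs <;> ring
  · simp only [matrix, entry, thetaV, Matrix.add_apply, Matrix.sum_apply, machinePiece, networkPiece,
      loadPiece, cross_apply, Sum.inl.injEq, Sum.inr.injEq, reduceCtorEq, and_false, false_and,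
      if_false, if_true, and_self, Finset.sum_add_distrib, add_zero, zero_add, Finset.sum_const_zero,
      ite_and, Finset.sum_ite_irrel, Finset.sum_ite_eq', Finset.mem_univ]
    by_cases hkl : k = l
    · subst hkl
      have hm : (∑ x, if T.bus x = k then -(2 * (T.E x / T.X x) * T.Sm x) / 2 else 0)
          = -∑ x, if T.bus x = k then T.E x / T.X x * T.Sm x else 0 := by
        rw [← Finset.sum_neg_distrib]
        exact Finset.sum_congr rfl fun x _ => by split_ifs <;> ring
      simp only [if_true, sum_ite_ite_same, hm, ← Finset.sum_div, Finset.sum_neg_distrib]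
      ring
    · simp only [hkl, Ne.symm hkl, if_false, sum_ite_ite_ne T hkl, zero_add, add_zero]
      ring
  · simp only [matrix, entry, vV, Matrix.add_apply, Matrix.sum_apply, machinePiece, networkPiece, loadPiece,
      cross_apply, Sum.inr.injEq, reduceCtorEq, and_false, false_and, if_false, if_true, and_self,
      Finset.sum_add_distrib, add_zero, Finset.sum_const_zero, ite_and, Finset.sum_ite_irrel,
      Finset.sum_ite_eq', Finset.mem_univ]
    by_cases hkl : k = l
    · subst hkl
      simp only [if_true, sum_ite_ite_same, sum_ite_div]
      ring
    · simp only [hkl, if_false, sum_ite_ite_ne T hkl, zero_add, add_zero]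
      ring

/-- The Gram matrix as the closed-form `Matrix.of entry` (use this form in kernel entry checks of
large instances). [cite: Padiyar2013, §3.4.4 eq (3.32)] -/
theorem matrix_eq_of_entry (T : HessianTables K m n) : T.matrix = Matrix.of T.entry := by
  ext I J
  rw [matrix_apply, Matrix.of_apply]

/-! ### Bridge from ANY positivity certificate of the pinned rational submatrix (APPEND, model-2 g9)

`hessianQuad_pos_of_ldlCertPD` (in `StructurePreservingDAEHessianMatrix.lean`) consumes the in-kernel
`LDLCertPD` self-certificate, whose exact elimination exceeds the kernel's capacity beyond `n ≈ 45`.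
For larger instances (the 39-bus pinned matrix is `87 × 87`) the positivity of the quadratic form of
the pinned submatrix is obtained by another lane (e.g. the rounded twin of
`Literature/Computation/Certificates/PsdRoundedTwin.lean`); the two theorems below take that
positivity statement itself as the hypothesis. -/

omit [CharZero K] in
/-- Positivity of `qf` of the real-cast Gram matrix on directions supported on `range f`, from ANY
proof that the pinned rational submatrix has positive quadratic form over `ℝ`.
[cite: BlekhermanParriloThomas2012, App. A.1.2] -/
theorem qf_pos_of_quadForm_pos {N : ℕ} (T : HessianTables ℚ m n) {f : Fin N → Idx m n}
    (hf : Function.Injective f)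
    (hA : ∀ x : Fin N → ℝ, x ≠ 0 →
      0 < ∑ i, ∑ j, x i * ((T.matrix.submatrix f f i j : ℚ) : ℝ) * x j)
    (d : Idx m n → ℝ) (hd : ∀ I, I ∉ Set.range f → d I = 0) (hd0 : d ≠ 0) :
    0 < qf (T.matrix.map (Rat.cast : ℚ → ℝ)) d := by
  classical
  set x : Fin N → ℝ := fun i => d (f i) with hxdef
  have hx0 : x ≠ 0 := by
    intro hx
    apply hd0
    funext I
    by_cases hI : I ∈ Set.range f
    · obtain ⟨i, rfl⟩ := hI
      exact congr_fun hx i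
    · exact hd I hI
  have hqf : qf (T.matrix.map (Rat.cast : ℚ → ℝ)) d
      = ∑ i, ∑ j, x i * ((T.matrix.submatrix f f) i j : ℝ) * x j := by
    unfold qf
    rw [sum_eq_sum_comp hf _ fun I hI => by simp [hd I hI]]
    refine Finset.sum_congr rfl fun i _ => ?_
    rw [sum_eq_sum_comp hf _ fun J hJ => by simp [hd J hJ]]
    simp [Matrix.submatrix_apply, Matrix.map_apply, hxdef]
  rw [hqf]
  exact hA x hx0

omit [CharZero K] in
/-- **The bridge for large instances**: real tables matching `(p, Q′_L, δ*, V*, θ*)` that are the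
cast of rational tables `TQ`, all `X′_d ≠ 0`, an index map `f` missing exactly the bus angle `k₀`,
and ANY proof that the pinned rational Gram submatrix has positive quadratic form over `ℝ` ⇒
`hessianQuad` is positive on every nonzero direction with `φ_{k₀} = 0`.
[cite: Padiyar2013, §3.4.4 eqs (3.32)–(3.37)] -/
theorem hessianQuad_pos_of_quadForm_pos {p : Params m n} {QL' : Fin n → ℝ → ℝ} {δ : Fin m → ℝ}
    {V θ : Fin n → ℝ} (TQ : HessianTables ℚ m n)
    (hT : (TQ.map (Rat.castHom ℝ)).Matches p QL' δ V θ) (hX : ∀ i, TQ.X i ≠ 0)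
    {N : ℕ} {f : Fin N → Idx m n} (hf : Function.Injective f) (k₀ : Fin n)
    (hrange : ∀ I : Idx m n, I ≠ Sum.inr (Sum.inl k₀) → I ∈ Set.range f)
    (hA : ∀ x : Fin N → ℝ, x ≠ 0 →
      0 < ∑ i, ∑ j, x i * ((TQ.matrix.submatrix f f i j : ℚ) : ℝ) * x j)
    (a : Fin m → ℝ) (u φ : Fin n → ℝ) (hφ : φ k₀ = 0) (hne : (a, u, φ) ≠ 0) :
    0 < p.hessianQuad QL' δ a V θ u φ := by
  have hXr : ∀ i, (TQ.map (Rat.castHom ℝ)).X i ≠ 0 := fun i => by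
    simpa [map] using hX i
  rw [hessianQuad_eq_quad hT, quad_eq_qf _ hXr, matrix_map]
  have hmapeq : TQ.matrix.map (Rat.castHom ℝ) = TQ.matrix.map (Rat.cast : ℚ → ℝ) := rfl
  rw [hmapeq]
  refine qf_pos_of_quadForm_pos TQ hf hA (dir a u φ) (fun I hI => ?_) ?_
  · have hI : I = Sum.inr (Sum.inl k₀) := by
      by_contra h
      exact hI (hrange I h)
    subst hI
    simpa [dir] using hφ
  · intro h
    apply hne
    have ha : a = 0 := funext fun i => by simpa [dir] using congr_fun h (Sum.inl i)
    have hφ0 : φ = 0 := funext fun k => by simpa [dir] using congr_fun h (Sum.inr (Sum.inl k))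
    have hu : u = 0 := funext fun k => by simpa [dir] using congr_fun h (Sum.inr (Sum.inr k))
    simp [ha, hφ0, hu]

end Summit.Ventures.GridStability.Models.StructurePreservingDAE.HessianTables

end
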